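import Mathlib
import Literature.Combinatorics.Enumerative.AperyNumbers
import Literature.Combinatorics.Enumerative.AperyNumbersZetaTwo

/-!
# RecurrenceBlockLaw — the `p`-block law for solutions of Apéry-type recurrences modulo `p` (cell zeta5-irr)

HONEST FRAMING: systematic search; no irrationality claim unless certified. INSTRUMENT lemma of the ζ(5)
census cell zeta5-irr (HOME `run/shared/lean/pub/zeta5-irr/`; memo `zi-p2/LEMMAS.md` §B8, finding
`zi-p2/FINDINGS-DENOM.md` §2.10, probe `zi-p2/probes/B8/` kit j245421). Nothing here is about ζ(5); no
irrationality content; filing moves no rung. Filed by the cell's engine seat zi-eng (g3).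

## What the cell observed (zi-p2 g7, probe B8 «Stage H», 358 block tests, 100 %)

For the Apéry families F2 (`ζ(2)`), F3 (`ζ(3)`) and the Ball–Rivoal family F5, with `x_pure` the integer
(«pure period») solution and `x₀` the rational approximant solution of the family's recurrence, on every block
`kp ≤ n < (k+1)p` (`11 ≤ p`, `k < p`):
* H1 «proportionality»: the columns `(p^τ x₀(n))_n` and `(x_pure(n))_n` restricted to the block have `𝔽_p`-rank `≤ 1`;
* H2 «approximant»: `p^τ x₀(kp+m) ≡ (x₀(k)/x_pure(k))·x_pure(kp+m) (mod p)`;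
* H3 «Lucas»: `x_pure(kp+m) ≡ x_pure(k)·x_pure(m) (mod p)`.

## What is PROVED here (the mechanism behind H1, and the reduction of H2)

* `IsSolution d ℓ c X` — a `ZMod p`-valued sequence solving `ℓ(n)·X(n+1) = Σ_{i<d} cᵢ(n)·X(n−i)` for all
  `n : ℕ`, the coefficients being functions of the residue `n mod p` (as they are for any recurrence with
  integer-polynomial coefficients reduced mod `p`).
* **`block_law`** — if the trailing coefficients vanish at a block start (`cᵢ(m) = 0` for residues `m < i`:
  the recurrence started at a multiple of `p` never looks behind it) and the leading coefficient `ℓ(m)` is a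
  unit for residues `m ≤ p − 2`, then EVERY solution `X` satisfies, for all `k` and all `m < p`,
  `X(kp + m) = A(m) · X(kp)`, where `A` is any solution with `A(0) = 1` (for F2/F3: the pure sequence).
  Consequences: H1 holds for every pair of solutions (both block-columns are multiples of `(A(m))_{m<p}`,
  `block_rank_le_one`); H3 for `A` is `A(kp+m) = A(m)·A(kp)` plus the dilation value `A(kp) = A(k)`; and H2 is
  EQUIVALENT, given the block law, to the single «dilation congruence» `p^τ x₀(kp) ≡ x₀(k) (mod p)` — which this
  file does NOT prove (it stays OBSERVED in the cell's books; for F3 it is the `b`-analogue of Gessel's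
  `a_{pn} ≡ a_n`).
* Instances: the Apéry `ζ(3)` recurrence `(n+1)³u_{n+1} = (34n³+51n²+27n+5)u_n − n³u_{n−1}`
  (`apery3_isSolution_aperyNumber`, from the tree's `AperyNumbers.aperyNumber_rec'`) and the Apéry `ζ(2)` recurrence
  `(n+1)²u_{n+1} = (11n²+11n+3)u_n + n²u_{n−1}` (`apery2_isSolution_apery2Number`, from
  `AperyNumbersZetaTwo.apery2Number_rec`), with the block laws `apery3_block_law`, `apery2_block_law` for ALL their
  `ZMod p` solutions (in particular for `n ↦ p³·b_n mod p` on `n < p²` whenever `d_n³ b_n ∈ ℤ`, the cell's `x₀` of F3).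
  The Lucas congruence H3 itself for these two pure sequences is Gessel 1982 Thm 1, filed separately as
  `Literature/Combinatorics/Enumerative/AperyLucasCongruences.lean` (p408837).

Not here: F5 (order-3 Ball–Rivoal recurrence — the abstract `block_law` covers any order once the recurrence is in the
tree; it is not), the dilation congruence, anything `p`-adic beyond the first power.
-/

namespace Summit.KontsevichZagierPeriods.Zeta5Search.BlockLaw
open Finset

section General

variable {p : ℕ}

/-- `X : ℕ → ZMod p` solves the order-`d` linear recurrence with leading coefficient `ℓ` and trailing
coefficients `c₀, …, c_{d−1}`, all functions of `n mod p`: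
`ℓ(n)·X(n+1) = Σ_{i<d} cᵢ(n)·X(n−i)` for every `n : ℕ` (natural subtraction: at `n < i` the term reads
`cᵢ(n)·X(0)`, harmless under the block-start hypothesis of `block_law`). A hypothesis-bundling predicate
(«`X` solves the recurrence»), not a named fact. [folklore] -/
def IsSolution (d : ℕ) (ℓ : ZMod p → ZMod p) (c : ℕ → ZMod p → ZMod p) (X : ℕ → ZMod p) : Prop :=
  ∀ n : ℕ, ℓ (n : ZMod p) * X (n + 1) = ∑ i ∈ range d, c i (n : ZMod p) * X (n - i)

/-- The residue of a block index: `((k·p + m : ℕ) : ZMod p) = m`. -/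
theorem cast_block_index (k m : ℕ) : ((k * p + m : ℕ) : ZMod p) = (m : ZMod p) := by
  push_cast
  simp

variable [hp : Fact p.Prime]

/-- **Block law.** If the trailing coefficients satisfy `cᵢ(m) = 0` for residues `m < i < d` and the leading
coefficient `ℓ(m)` is nonzero for `m + 1 < p`, then every solution `X` is, on each block `kp ≤ n < (k+1)p`,
the normalised solution `A` (`A 0 = 1`) times its value at the block start: `X(kp+m) = A(m)·X(kp)` (`m < p`). -/
theorem block_law {d : ℕ} {ℓ : ZMod p → ZMod p} {c : ℕ → ZMod p → ZMod p}
    (hc : ∀ i m : ℕ, m < i → i < d → c i (m : ZMod p) = 0)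
    (hℓ : ∀ m : ℕ, m + 1 < p → ℓ (m : ZMod p) ≠ 0)
    {A X : ℕ → ZMod p} (hA : IsSolution d ℓ c A) (hA0 : A 0 = 1) (hX : IsSolution d ℓ c X)
    (k : ℕ) : ∀ m : ℕ, m < p → X (k * p + m) = A m * X (k * p) := by
  intro m
  induction m using Nat.strong_induction_on with
  | _ m ih =>
    intro hm
    rcases m with _ | m
    · simp [hA0]
    · have hXr := hX (k * p + m)
      have hAr := hA m
      rw [cast_block_index] at hXr
      have hsum : ∑ i ∈ range d, c i (m : ZMod p) * X (k * p + m - i)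
          = (∑ i ∈ range d, c i (m : ZMod p) * A (m - i)) * X (k * p) := by
        rw [Finset.sum_mul]
        refine Finset.sum_congr rfl fun i hi => ?_
        by_cases him : i ≤ m
        · rw [Nat.add_sub_assoc him (k * p), ih (m - i) (by omega) (by omega)]
          ring
        · rw [hc i m (by omega) (mem_range.mp hi)]
          simp
      rw [hsum, ← hAr, mul_assoc] at hXr
      have h := mul_left_cancel₀ (hℓ m hm) hXr
      rw [← h, Nat.add_succ]

/-- **H1 (rank ≤ 1 on blocks).** Under the hypotheses of `block_law`, for any two solutions `X, Y` the
block-columns are proportional to `(A(m))_{m<p}`: all `2 × 2` minors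
`X(kp+m)·Y(kp+m') − X(kp+m')·Y(kp+m)` vanish. -/
theorem block_rank_le_one {d : ℕ} {ℓ : ZMod p → ZMod p} {c : ℕ → ZMod p → ZMod p}
    (hc : ∀ i m : ℕ, m < i → i < d → c i (m : ZMod p) = 0)
    (hℓ : ∀ m : ℕ, m + 1 < p → ℓ (m : ZMod p) ≠ 0)
    {A X Y : ℕ → ZMod p} (hA : IsSolution d ℓ c A) (hA0 : A 0 = 1)
    (hX : IsSolution d ℓ c X) (hY : IsSolution d ℓ c Y)
    (k m m' : ℕ) (hm : m < p) (hm' : m' < p) :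
    X (k * p + m) * Y (k * p + m') = X (k * p + m') * Y (k * p + m) := by
  rw [block_law hc hℓ hA hA0 hX k m hm, block_law hc hℓ hA hA0 hX k m' hm',
    block_law hc hℓ hA hA0 hY k m hm, block_law hc hℓ hA hA0 hY k m' hm']
  ring

/-- **H2 ⟺ dilation congruence, given the block law.** If a solution `X` agrees with `λ·A` at the block
start `kp` (`X(kp) = λ·A(kp)`), then it agrees on the whole block: `X(kp+m) = λ·A(kp+m)` (`m < p`).  With
`X = p^τx₀`, `A = x_pure`, `λ = x₀(k)/x_pure(k)` this is exactly the cell's H2, so H2 reduces to its `m = 0`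
case `p^τ x₀(kp) ≡ (x₀(k)/x_pure(k))·x_pure(kp)` — i.e., with `x_pure(kp) ≡ x_pure(k)`, to the dilation
congruence `p^τ x₀(kp) ≡ x₀(k) (mod p)` (NOT proved here). -/
theorem block_law_of_start {d : ℕ} {ℓ : ZMod p → ZMod p} {c : ℕ → ZMod p → ZMod p}
    (hc : ∀ i m : ℕ, m < i → i < d → c i (m : ZMod p) = 0)
    (hℓ : ∀ m : ℕ, m + 1 < p → ℓ (m : ZMod p) ≠ 0)
    {A X : ℕ → ZMod p} (hA : IsSolution d ℓ c A) (hA0 : A 0 = 1) (hX : IsSolution d ℓ c X)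
    (k : ℕ) (lam : ZMod p) (hstart : X (k * p) = lam * A (k * p)) (m : ℕ) (hm : m < p) :
    X (k * p + m) = lam * A (k * p + m) := by
  rw [block_law hc hℓ hA hA0 hX k m hm, block_law hc hℓ hA hA0 hA k m hm, hstart]
  ring

/-- The leading coefficient `(t+1)^e` is a unit on residues `m` with `m + 1 < p`. -/
theorem pow_succ_cast_ne_zero (e m : ℕ) (hm : m + 1 < p) : ((m : ZMod p) + 1) ^ e ≠ 0 := by
  apply pow_ne_zero
  have h : ((m + 1 : ℕ) : ZMod p) ≠ 0 := by
    rw [Ne, ZMod.natCast_eq_zero_iff]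
    exact fun hd => absurd (Nat.le_of_dvd (by omega) hd) (by omega)
  simpa using h

end General

/-! ## The Apéry `ζ(3)` recurrence `(n+1)³ u_{n+1} = (34n³+51n²+27n+5) u_n − n³ u_{n−1}` -/

section AperyThree

variable {p : ℕ}

/-- Leading coefficient `ℓ(t) = (t+1)³` of Apéry's `ζ(3)` recurrence. -/
def apery3Lead (t : ZMod p) : ZMod p := (t + 1) ^ 3

/-- Trailing coefficients of Apéry's `ζ(3)` recurrence: `c₀(t) = 34t³+51t²+27t+5`, `c₁(t) = −t³`, `cᵢ = 0` else. -/
def apery3Coeff : ℕ → ZMod p → ZMod p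
  | 0, t => 34 * t ^ 3 + 51 * t ^ 2 + 27 * t + 5
  | 1, t => -t ^ 3
  | _ + 2, _ => 0

/-- Block-start vanishing for the `ζ(3)` recurrence: `c₁(0) = 0` (the `n³ u_{n−1}` term dies at `n ≡ 0`). -/
theorem apery3Coeff_blockStart (i m : ℕ) (hmi : m < i) (hi : i < 2) :
    apery3Coeff i (m : ZMod p) = 0 := by
  interval_cases i
  · omega
  · interval_cases m
    simp [apery3Coeff]

variable [hp : Fact p.Prime]

/-- The Apéry numbers `a_n = Σ_k C(n,k)²C(n+k,k)²` (cast to `ZMod p`) solve the `ζ(3)` recurrence — the tree's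
`AperyNumbers.aperyNumber_rec'` reduced mod `p` (and `a₁ = 5·a₀` at `n = 0`). -/
theorem apery3_isSolution_aperyNumber :
    IsSolution 2 apery3Lead apery3Coeff
      (fun n => (Literature.Combinatorics.Enumerative.AperyNumbers.aperyNumber n : ZMod p)) := by
  intro n
  simp only [Finset.sum_range_succ, Finset.sum_range_zero, zero_add, apery3Lead, apery3Coeff,
    Nat.sub_zero]
  rcases Nat.eq_zero_or_pos n with hn | hn
  · subst hn
    simp [Literature.Combinatorics.Enumerative.AperyNumbers.aperyNumber_one,
      Literature.Combinatorics.Enumerative.AperyNumbers.aperyNumber_zero]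
  · have h := Literature.Combinatorics.Enumerative.AperyNumbers.aperyNumber_rec' (n := n) hn
    have hc := congrArg (Int.cast : ℤ → ZMod p) h
    push_cast at hc
    linear_combination hc

/-- **Block law for the Apéry `ζ(3)` recurrence**: every `ZMod p` solution `X` satisfies
`X(kp + m) = a_m · X(kp)` for `m < p` (`a_m` the Apéry numbers).  For `X = a` this is the block form of
Gessel's Lucas congruence; for `X = p³b mod p` (`b` Apéry's second solution, `p ≤ n < p²`) it is the cell's H1/H2
mechanism. -/
theorem apery3_block_law {X : ℕ → ZMod p} (hX : IsSolution 2 apery3Lead apery3Coeff X)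
    (k m : ℕ) (hm : m < p) :
    X (k * p + m) = (Literature.Combinatorics.Enumerative.AperyNumbers.aperyNumber m : ZMod p) * X (k * p) :=
  block_law (A := fun n => (Literature.Combinatorics.Enumerative.AperyNumbers.aperyNumber n : ZMod p))
    apery3Coeff_blockStart (fun m hm => pow_succ_cast_ne_zero 3 m hm)
    apery3_isSolution_aperyNumber
    (by simp [Literature.Combinatorics.Enumerative.AperyNumbers.aperyNumber_zero]) hX k m hm

/-- **H1 for the Apéry `ζ(3)` recurrence**: any two `ZMod p` solutions are proportional on every block. -/
theorem apery3_block_rank_le_one {X Y : ℕ → ZMod p}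
    (hX : IsSolution 2 apery3Lead apery3Coeff X) (hY : IsSolution 2 apery3Lead apery3Coeff Y)
    (k m m' : ℕ) (hm : m < p) (hm' : m' < p) :
    X (k * p + m) * Y (k * p + m') = X (k * p + m') * Y (k * p + m) :=
  block_rank_le_one (A := fun n => (Literature.Combinatorics.Enumerative.AperyNumbers.aperyNumber n : ZMod p))
    apery3Coeff_blockStart (fun m hm => pow_succ_cast_ne_zero 3 m hm)
    apery3_isSolution_aperyNumber
    (by simp [Literature.Combinatorics.Enumerative.AperyNumbers.aperyNumber_zero]) hX hY k m m' hm hm'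

end AperyThree

/-! ## The Apéry `ζ(2)` recurrence `(n+1)² u_{n+1} = (11n²+11n+3) u_n + n² u_{n−1}` -/

section AperyTwo

variable {p : ℕ}

/-- Leading coefficient `ℓ(t) = (t+1)²` of Apéry's `ζ(2)` recurrence. -/
def apery2Lead (t : ZMod p) : ZMod p := (t + 1) ^ 2

/-- Trailing coefficients of Apéry's `ζ(2)` recurrence: `c₀(t) = 11t²+11t+3`, `c₁(t) = t²`, `cᵢ = 0` else. -/
def apery2Coeff : ℕ → ZMod p → ZMod p
  | 0, t => 11 * t ^ 2 + 11 * t + 3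
  | 1, t => t ^ 2
  | _ + 2, _ => 0

/-- Block-start vanishing for the `ζ(2)` recurrence: `c₁(0) = 0`. -/
theorem apery2Coeff_blockStart (i m : ℕ) (hmi : m < i) (hi : i < 2) :
    apery2Coeff i (m : ZMod p) = 0 := by
  interval_cases i
  · omega
  · interval_cases m
    simp [apery2Coeff]

variable [hp : Fact p.Prime]

/-- Apéry's `ζ(2)` numbers `Σ_k C(n,k)²C(n+k,k)` (cast to `ZMod p`) solve the `ζ(2)` recurrence — the tree's
`AperyNumbersZetaTwo.apery2Number_rec` reduced mod `p` (and `B₁ = 3·B₀` at `n = 0`). -/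
theorem apery2_isSolution_apery2Number :
    IsSolution 2 apery2Lead apery2Coeff
      (fun n => (Literature.Combinatorics.Enumerative.AperyNumbersZetaTwo.apery2Number n : ZMod p)) := by
  intro n
  simp only [Finset.sum_range_succ, Finset.sum_range_zero, zero_add, apery2Lead, apery2Coeff,
    Nat.sub_zero]
  rcases n with _ | n
  · simp [Literature.Combinatorics.Enumerative.AperyNumbersZetaTwo.apery2Number_one,
      Literature.Combinatorics.Enumerative.AperyNumbersZetaTwo.apery2Number_zero]
  · have h := Literature.Combinatorics.Enumerative.AperyNumbersZetaTwo.apery2Number_rec n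
    have hc := congrArg (Nat.cast : ℕ → ZMod p) h
    push_cast at hc
    simp only [Nat.add_sub_cancel]
    push_cast
    linear_combination hc

/-- **Block law for the Apéry `ζ(2)` recurrence**: every `ZMod p` solution `X` satisfies
`X(kp + m) = B_m · X(kp)` for `m < p` (`B_m = Σ_k C(m,k)²C(m+k,k)`). -/
theorem apery2_block_law {X : ℕ → ZMod p} (hX : IsSolution 2 apery2Lead apery2Coeff X)
    (k m : ℕ) (hm : m < p) :
    X (k * p + m)
      = (Literature.Combinatorics.Enumerative.AperyNumbersZetaTwo.apery2Number m : ZMod p) * X (k * p) :=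
  block_law (A := fun n => (Literature.Combinatorics.Enumerative.AperyNumbersZetaTwo.apery2Number n : ZMod p))
    apery2Coeff_blockStart (fun m hm => pow_succ_cast_ne_zero 2 m hm)
    apery2_isSolution_apery2Number
    (by simp [Literature.Combinatorics.Enumerative.AperyNumbersZetaTwo.apery2Number_zero]) hX k m hm

/-- **H1 for the Apéry `ζ(2)` recurrence**: any two `ZMod p` solutions are proportional on every block. -/
theorem apery2_block_rank_le_one {X Y : ℕ → ZMod p}
    (hX : IsSolution 2 apery2Lead apery2Coeff X) (hY : IsSolution 2 apery2Lead apery2Coeff Y)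
    (k m m' : ℕ) (hm : m < p) (hm' : m' < p) :
    X (k * p + m) * Y (k * p + m') = X (k * p + m') * Y (k * p + m) :=
  block_rank_le_one
    (A := fun n => (Literature.Combinatorics.Enumerative.AperyNumbersZetaTwo.apery2Number n : ZMod p))
    apery2Coeff_blockStart (fun m hm => pow_succ_cast_ne_zero 2 m hm)
    apery2_isSolution_apery2Number
    (by simp [Literature.Combinatorics.Enumerative.AperyNumbersZetaTwo.apery2Number_zero]) hX hY k m m' hm hm'

end AperyTwo

end Summit.KontsevichZagierPeriods.Zeta5Search.BlockLaw
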